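import Literature.AnabelianGeometry.SemiGraphs.PSCThm16InputsSmoothProperGenuine
import Literature.AnabelianGeometry.SemiGraphs.PSCCompactificationTransfer
import HarnessLib

/-!
# "We may assume `Σ = {l}`" at genuine smooth-CURVE data: the maximal pro-`S` quotient is a genuine smooth curve

Mochizuki, *A combinatorial version of the Grothendieck conjecture* [CombGC], Tohoku Math. J. **59**
(2007), §1, proof of Thm. 1.6, p. 13 ("we may assume, without loss of generality, that `Σ = {l}`"):
the image of a semi-graph of anabelioids of pro-`Σ` PSC-type along the maximal pro-`S` quotient of
`Π_G` (`∅ ≠ S ⊆ Σ`) is of pro-`S` PSC-type; Def. 1.1 (i)–(ii) p. 6. [cite: MochizukiCombGC2007, Thm 1.6 p.13]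
[cite: MochizukiCombGC2007, Def 1.1(ii) p.6]

PROOF-ONLY file (abc-iut cell, layer L3, L-F sub-cell [SemiAnbd]+[CombGC] pack C, row
«MAPALONG@SC-GENUINE», seat abc-iut-w5-d174 gen 5; the smooth-CURVE twin of abc-iut-w5-d183's
`mapAlong_smoothProperGenuine` in `PSCThm16InputsSmoothProperGenuine.lean`, companion of
`PSCSmoothCurveGenuineCompactify.lean`).  The origin-level closure statement
`MapAlongProLOfPSCTypeHolds Ω` (`PSCCoveringMapAlong.lean`) is one of the thirteen named inputs of the
[CombGC] Thm. 1.6 capstone (`thm16_holds_of_inputs`).  At abc-iut-w5-d195's covering-closed pro-`ℓ`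
GENUINE smooth-curve origin it holds:

* `mapAlong_smoothCurveGenuine` — for a genuine smooth-curve datum `G` (profinite `Π`, no nodes,
  `Π_v = Π`, one vertex, a pro-`Σ` completion `ι : Γ_{g,r} → Π`, cusp groups
  `δ_c · closure ι⟨c_{e c}⟩ · δ_c⁻¹`, `genus ≡ g`), `∅ ≠ S ⊆ Σ`, and a presentation `f : Π ↠ Q` of the
  maximal pro-`S` quotient (`Q` Hausdorff), the image datum `G.mapAlong f` is genuine smooth-curve of
  the same type `(g, r)` over the profinite `Q`, along `f ∘ ι` (abc-iut-L3's
  `comp_isMaxProSigmaQuotient`), with cusp groups `f(δ_c) · closure (f∘ι)⟨c_{e c}⟩ · f(δ_c)⁻¹`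
  (`f` is a closed map: `f(closure X) = closure f(X)`, abc-iut's `map_topologicalClosure_eq_of_isClosedMap`);
* `mapAlongProLOfPSCTypeHolds_of_smoothCurveGenuine` — **`MapAlongProLOfPSCTypeHolds Ω`** for every
  origin whose membership predicate is (both ways) the pro-`ℓ` genuine smooth-curve shape (verbatim the
  `let Ω` of `exists_smoothCurveGenuineProLOrigin_holds`; there `S ⊆ {ℓ}` forces `S = {ℓ}`).

0 definitions; consistency / non-vacuity infrastructure for genuine one-component data with cusps; not
the printed theorems for all pointed stable curves; nothing here takes a side on [IUTchIII] Cor. 3.12.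
-/

noncomputable section

namespace Literature.AnabelianGeometry.SemiGraphs

namespace PSCDatum

open scoped Pointwise
open Literature.GroupTheory.CombinatorialGroupTheory
open Literature.GroupTheory.CombinatorialGroupTheory.PuncturedSurfaceGroup (cuspInertia IsHyperbolicType)
open SemiGraphOfAnabelioids (IsProSigmaCompletion)

universe u

variable {P : Type u} [Group P] [TopologicalSpace P] [IsTopologicalGroup P]

/-- A Hausdorff quotient of a profinite group is profinite. [folklore] -/
private theorem compact_totallyDisconnected_of_surjective [CompactSpace P] [TotallyDisconnectedSpace P]
    {Q : Type u} [Group Q] [TopologicalSpace Q] [IsTopologicalGroup Q] [T2Space Q]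
    (f : P →* Q) (hf : Continuous f) (hs : Function.Surjective f) :
    CompactSpace Q ∧ TotallyDisconnectedSpace Q := by
  haveI : CompactSpace Q := ⟨by rw [← hs.range_eq]; exact isCompact_range hf⟩
  have hK : IsClosed (f.ker : Set P) := by
    have : (f.ker : Set P) = f ⁻¹' {1} := by
      ext x
      simp only [SetLike.mem_coe, MonoidHom.mem_ker, Set.mem_preimage, Set.mem_singleton_iff]
    rw [this]
    exact isClosed_singleton.preimage hf
  haveI := AbsoluteAnabelian.QuotientGroup.totallyDisconnectedSpace_of_isClosed f.ker hK
  let φ : P ⧸ f.ker ≃* Q := QuotientGroup.quotientKerEquivOfSurjective f hs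
  have hφ : Continuous φ := by
    refine (QuotientGroup.isQuotientMap_mk f.ker).continuous_iff.mpr ?_
    have : (φ : P ⧸ f.ker → Q) ∘ QuotientGroup.mk = f := by
      funext x
      rfl
    rw [this]
    exact hf
  exact ⟨inferInstance, (Continuous.homeoOfEquivCompactToT2 (f := φ.toEquiv) hφ).totallyDisconnectedSpace⟩

/-- **"We may assume `Σ = {l}`" at a genuine smooth-curve datum** ([CombGC] Thm. 1.6 proof, p. 13).
Let `G` be a PSC datum over the profinite `Π` with no nodes, `Π_v = Π` for every vertex, one vertex
`v₀`, a pro-`Σ` completion `ι : Γ_{g,r} → Π` (`Σ = G.Sigma`), a bijection `e : cusps ≃ Fin r`, cusp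
groups conjugates of the closed cusp inertia groups, `genus ≡ g`.  For `∅ ≠ S ⊆ Σ` and a presentation
`f : Π ↠ Q` of the maximal pro-`S` quotient of `Π` (`Q` Hausdorff), the image datum `G' = G.mapAlong f`
is a genuine smooth-curve datum of the same type `(g, r)`: `Q` is profinite, no nodes, one vertex with
`Π'_v = Q`, genus `g`, `f ∘ ι : Γ_{g,r} → Q` is a pro-`S` completion, and the cusp groups of `G'` are
conjugates of the closed cusp inertia groups `closure (f ∘ ι)⟨c_{e c}⟩`.
[cite: MochizukiCombGC2007, Thm 1.6(i) p.13] -/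
theorem mapAlong_smoothCurveGenuine [CompactSpace P] [TotallyDisconnectedSpace P]
    (G : PSCDatum P) [IsEmpty G.graph.N] (hV : ∀ v, G.vertGp v = ⊤) (v₀ : G.graph.V)
    (hv : ∀ w, w = v₀) {g r : ℕ} (ι : PuncturedSurfaceGroup g r →* P)
    (hι : IsProSigmaCompletion G.Sigma ι) (e : G.graph.C ≃ Fin r)
    (hC : ∀ c, ∃ δ : ConjAct P,
      G.cuspGp c = δ • ((cuspInertia (g := g) (e c)).map ι).topologicalClosure)
    (hgen : ∀ v, G.genus v = g)
    {Q : Type u} [Group Q] [TopologicalSpace Q] [IsTopologicalGroup Q] [T2Space Q]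
    (S : Set ℕ) (hS : S ⊆ G.Sigma) (hne : S.Nonempty) (f : P →* Q) (h : IsMaxProSigmaQuotient S f) :
    CompactSpace Q ∧ TotallyDisconnectedSpace Q ∧
      IsEmpty (G.mapAlong f h.continuous S hS hne h.proSigma).graph.N ∧
      (∀ w, (G.mapAlong f h.continuous S hS hne h.proSigma).vertGp w = ⊤) ∧
      (∃ w₀ : (G.mapAlong f h.continuous S hS hne h.proSigma).graph.V, ∀ w, w = w₀) ∧
      IsProSigmaCompletion (G.mapAlong f h.continuous S hS hne h.proSigma).Sigma (f.comp ι) ∧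
      (∀ w, (G.mapAlong f h.continuous S hS hne h.proSigma).genus w = g) ∧
      ∀ c, ∃ δ : ConjAct Q, (G.mapAlong f h.continuous S hS hne h.proSigma).cuspGp c =
        δ • ((cuspInertia (g := g) (e c)).map (f.comp ι)).topologicalClosure := by
  obtain ⟨hcQ, htQ⟩ := compact_totallyDisconnected_of_surjective f h.continuous h.surjective
  have hι' : IsProSigmaCompletion S (f.comp ι) := IsProSigmaCompletion.comp_isMaxProSigmaQuotient hS hι h
  have hcl : IsClosedMap f := h.continuous.isClosedMap
  refine ⟨hcQ, htQ, inferInstanceAs (IsEmpty G.graph.N), fun w => ?_, ⟨v₀, hv⟩, hι', fun w => hgen w,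
    fun c => ?_⟩
  · rw [mapAlong_vertGp, hV, Subgroup.map_top_of_surjective f h.surjective]
  · obtain ⟨δ, hδ⟩ := hC c
    refine ⟨ConjAct.toConjAct (f (ConjAct.ofConjAct δ)), ?_⟩
    rw [mapAlong_cuspGp, hδ, map_conj_smul, map_topologicalClosure_eq_of_isClosedMap f h.continuous hcl,
      Subgroup.map_map]

/-! ### The origin-level statement at pro-`ℓ` genuine smooth-curve origins -/

/-- **`MapAlongProLOfPSCTypeHolds Ω` ("we may assume `Σ = {l}`" as an origin-closure statement) HOLDS at
every pro-`ℓ` genuine smooth-curve origin**: if the membership predicate of `Ω` is (in both directions)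
the pro-`ℓ` genuine smooth-curve shape — verbatim the `let Ω` of abc-iut-w5-d195's
`exists_smoothCurveGenuineProLOrigin_holds` — then the image of every `Ω`-datum along every presentation
of a maximal pro-`S` quotient (`∅ ≠ S ⊆ Σ = {ℓ}`, so `S = {ℓ}`) is an `Ω`-datum.
[cite: MochizukiCombGC2007, Thm 1.6(i) p.13] -/
theorem mapAlongProLOfPSCTypeHolds_of_smoothCurveGenuine (ℓ : ℕ) (Ω : PSCOrigin.{u})
    (hout : ∀ ⦃Q : Type u⦄ [Group Q] [TopologicalSpace Q] (G : PSCDatum Q), Ω.IsOfPSCType G →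
      ∃ (_ : IsTopologicalGroup Q), CompactSpace Q ∧ T2Space Q ∧
        TotallyDisconnectedSpace Q ∧ IsEmpty G.graph.N ∧ (∀ v, G.vertGp v = ⊤) ∧
        (∃ v₀ : G.graph.V, ∀ w, w = v₀) ∧ G.Sigma = {ℓ} ∧
        ∃ (g r : ℕ) (ι : PuncturedSurfaceGroup g r →* Q) (e : G.graph.C ≃ Fin r),
          IsHyperbolicType g r ∧ IsProSigmaCompletion G.Sigma ι ∧ (∀ v, G.genus v = g) ∧
          ∀ c, ∃ δ : ConjAct Q, G.cuspGp c = δ • ((cuspInertia (g := g) (e c)).map ι).topologicalClosure)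
    (hin : ∀ ⦃Q : Type u⦄ [Group Q] [TopologicalSpace Q] (G : PSCDatum Q),
      (∃ (_ : IsTopologicalGroup Q), CompactSpace Q ∧ T2Space Q ∧
        TotallyDisconnectedSpace Q ∧ IsEmpty G.graph.N ∧ (∀ v, G.vertGp v = ⊤) ∧
        (∃ v₀ : G.graph.V, ∀ w, w = v₀) ∧ G.Sigma = {ℓ} ∧
        ∃ (g r : ℕ) (ι : PuncturedSurfaceGroup g r →* Q) (e : G.graph.C ≃ Fin r),
          IsHyperbolicType g r ∧ IsProSigmaCompletion G.Sigma ι ∧ (∀ v, G.genus v = g) ∧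
          ∀ c, ∃ δ : ConjAct Q, G.cuspGp c =
            δ • ((cuspInertia (g := g) (e c)).map ι).topologicalClosure) → Ω.IsOfPSCType G) :
    MapAlongProLOfPSCTypeHolds Ω := by
  intro P _ _ _ _ Q _ _ _ _ G S hS hne f h hG
  obtain ⟨_, _, _, htP, hN, hV, ⟨v₀, hv⟩, hSig, g, r, ι, e, hgr, hι, hgen, hC⟩ := hout G hG
  haveI := hN
  haveI := htP
  obtain ⟨_, htQ, hN', hV', hv', hι', hgen', hC'⟩ :=
    G.mapAlong_smoothCurveGenuine hV v₀ hv ι hι e hC hgen S hS hne f h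
  have hS' : S = {ℓ} := (hne.subset_singleton_iff).mp (hSig ▸ hS)
  exact hin _ ⟨inferInstance, inferInstance, inferInstance, htQ, hN', hV', hv', hS', g, r, f.comp ι, e,
    hgr, hι', hgen', hC'⟩

end PSCDatum

end Literature.AnabelianGeometry.SemiGraphs

end
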